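import Mathlib.Analysis.Matrix.PosDef
import Mathlib.LinearAlgebra.Charpoly.ToMatrix
import Summits.QuantumFields.QCD.Theorems.ExtinctionBuildsQCD.Negative.ChiralInertia
import Summits.QuantumFields.QCD.Theorems.WindowExtinction.Negative.SpectralFlowLocal
import Summits.QuantumFields.QCD.Theorems.SpectralDefectExtinctionTipPricingStubKyFanCountAux

/-!
# Stub `stub_kyFan` (S4b, Ky Fan counting) of line `chessboard-cold-cells`
(crux `Summit.QuantumFields.QCD.Theses.SpectralDefectExtinction.WindowExtinction`, item stmt-QuantumFields-8964)

**Ky Fan counting.**  For every complex square matrix `D` whose Hermitian part `D + Dᴴ` is positive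
semidefinite and every real `η`:

  `#{roots z of χ_D (with multiplicity) : Re z < η} ≤ 2 · #{roots of χ_{½(D + Dᴴ)} : Re z < 2η}`,

i.e. the number of eigenvalues of the (non-normal) `D` with small real part, counted with algebraic
multiplicity, is at most twice the number of eigenvalues of the PSD Hermitian part `Re D = ½(D + Dᴴ)`
below `2η`.

**Proof (trace count on a spectral subspace, no Schur flag).**  Work on `E = EuclideanSpace ℂ n` with
`f = toEuclideanLin D`, so `χ_f = χ_D` and `Re⟪x, f x⟫ = Re(x† D x) = x† (Re D) x ≥ 0`.
* The tree's `stub_kyFanTraceCount` (file `SpectralDefectExtinctionTipPricingStubKyFanCountAux.lean`,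
  Mathlib-only linear algebra) supplies the `f`-invariant spectral subspace
  `V = ⨆_{Re z < η} maxGenEigenspace f z` with `dim V = k` (the left count) and
  `tr f|_V = Σ_{Re z < η} z`, hence `Re tr f|_V < kη` if `k ≥ 1`, together with the trace floor
  `c · dim(V ∩ K) ≤ Re tr f|_V` for every subspace `K` on which `Re⟪x, f x⟫ ≥ c‖x‖²`, and
  `dim V + dim K ≤ dim E + dim(V ∩ K)`.
* Floor subspace: with `Re D = U diag(λ) U†` (Mathlib's `eigenvectorUnitary`), the subspace
  `W = {x : (U† x)_i = 0 whenever λ_i < 2η}` has `dim W ≥ |n| − M`, `M = #{i : λ_i < 2η}` (rank–nullity),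
  and `Re⟪x, f x⟫ = Σ_i λ_i |(U†x)_i|² ≥ 2η‖x‖²` on `W` (`re_form_eq_sum_eigenvalues`, Parseval).
* Hence `2η · dim(V ∩ W) ≤ Re tr f|_V < kη` and `k ≤ dim(V ∩ W) + M`; also `0 ≤ Re tr f|_V`, so `k ≥ 1`
  forces `η > 0`, then `2 dim(V ∩ W) < k ≤ dim(V ∩ W) + M` gives `k < 2M`.  (`k = 0` is trivial.)
The right count is `M` because the roots of `χ_{Re D}` are the `λ_i` (`countP_roots_charpoly_eq_card`).

References for the mathematics: Ky Fan, Proc. NAS 36 (1950) 31–35; R. Bhatia, *Matrix Analysis* (1997),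
Prop. III.5.3.  Everything leaned on is proved in the tree (`ChiralInertia.lean`, `SpectralFlowLocal.lean`,
the Aux file) or in Mathlib; no named facts.
-/

namespace Summit.QuantumFields.QCD.Cruxes.WindowExtinction.ChessboardColdCells

open scoped Matrix ComplexOrder InnerProductSpace
open Matrix
open Summit.QuantumFields.QCD.Theorems.ExtinctionBuildsQCD.Negative
open Summit.QuantumFields.QCD.Theorems.WindowExtinction.Negative

noncomputable section

section Helpers

variable {n : Type*} [Fintype n] [DecidableEq n]

/-- `Re⟪x, toEuclideanLin A x⟫ = Re(x† A x)`. -/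
-- adapted from Theorems/SpectralDefectExtinctionTipPricingStubKyFanCount.lean
theorem kyFan_re_inner_toEuclideanLin_eq (A : Matrix n n ℂ) (x : EuclideanSpace ℂ n) :
    (⟪x, toEuclideanLin A x⟫_ℂ).re = (star (WithLp.ofLp x) ⬝ᵥ A *ᵥ WithLp.ofLp x).re := by
  rw [EuclideanSpace.inner_eq_star_dotProduct, Matrix.ofLp_toLpLin, Matrix.toLin'_apply,
    dotProduct_comm]

omit [DecidableEq n] in
/-- `Re(v† Aᴴ v) = Re(v† A v)`. -/
-- adapted from Theorems/SpectralDefectExtinctionTipPricingStubKyFanCount.lean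
theorem kyFan_re_form_conjTranspose (A : Matrix n n ℂ) (v : n → ℂ) :
    (star v ⬝ᵥ Aᴴ *ᵥ v).re = (star v ⬝ᵥ A *ᵥ v).re := by
  rw [mulVec_conjTranspose, star_dotProduct_star, ← dotProduct_mulVec, Complex.star_def,
    Complex.conj_re]

omit [DecidableEq n] in
/-- The real part of the form of `D` is the form of its Hermitian part `½(D + Dᴴ)`. -/
theorem kyFan_re_form_hermitianPart (D : Matrix n n ℂ) (v : n → ℂ) :
    (star v ⬝ᵥ ((1 / 2 : ℂ) • (D + Dᴴ)) *ᵥ v).re = (star v ⬝ᵥ D *ᵥ v).re := by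
  rw [smul_mulVec, dotProduct_smul, add_mulVec, dotProduct_add, smul_eq_mul,
    show (1 / 2 : ℂ) = ((1 / 2 : ℝ) : ℂ) by norm_num, Complex.re_ofReal_mul, Complex.add_re,
    kyFan_re_form_conjTranspose]
  ring

end Helpers

/-- **Ky Fan counting** (registered stub `stub_kyFan`, S4b of line `chessboard-cold-cells`).  For every
complex square matrix `D` with positive semidefinite Hermitian part `D + Dᴴ` and every real `η`, the
number of roots `z` of the characteristic polynomial of `D` with `Re z < η` (algebraic multiplicity) is
at most twice the number of roots of the characteristic polynomial of `½(D + Dᴴ)` with real part `< 2η`.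
Proof: trace of `f = toEuclideanLin D` on the spectral subspace `V` below `Re z < η` (`dim V = k`,
`Re tr f|_V = Σ Re z < kη`, `stub_kyFanTraceCount`) against the floor `Re⟪x, f x⟫ ≥ 2η‖x‖²` on the
subspace `W` orthogonal to the eigenvectors of `½(D + Dᴴ)` of level `< 2η` (`dim W ≥ |n| − M`):
`2η · dim(V ∩ W) ≤ Re tr f|_V < kη` with `dim(V ∩ W) ≥ k − M`, whence `k < 2M` (and `k = 0` if `η ≤ 0`,
since `Re tr f|_V ≥ 0`). -/
theorem stub_kyFan : ∀ (n : Type) [Fintype n] [DecidableEq n] (D : Matrix n n ℂ) (η : ℝ), (D + Dᴴ).PosSemidef →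
    (D.charpoly.roots.countP (fun z : ℂ => z.re < η) : ℝ) ≤
      2 * (((1 / 2 : ℂ) • (D + Dᴴ)).charpoly.roots.countP (fun z : ℂ => z.re < 2 * η) : ℝ) := by
  intro n _ _ D η hPSD
  -- the Hermitian part `H = ½(D + Dᴴ)` is positive semidefinite
  have h12 : (0 : ℂ) ≤ (1 / 2 : ℂ) := by
    rw [show (1 / 2 : ℂ) = ((1 / 2 : ℝ) : ℂ) by norm_num]
    exact Complex.zero_le_real.mpr (by norm_num)
  have hPSDH : ((1 / 2 : ℂ) • (D + Dᴴ)).PosSemidef := hPSD.smul h12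
  have hH : ((1 / 2 : ℂ) • (D + Dᴴ)).IsHermitian := hPSDH.isHermitian
  -- the right count is an eigenvalue count `M`
  set M := (Finset.univ.filter fun i => hH.eigenvalues i < 2 * η).card with hMdef
  have hM : ((1 / 2 : ℂ) • (D + Dᴴ)).charpoly.roots.countP (fun z : ℂ => z.re < 2 * η) = M := by
    rw [hMdef, countP_roots_charpoly_eq_card hH (fun z : ℂ => z.re < 2 * η)]
    simp only [Complex.ofReal_re]
  rw [hM]
  -- `f = toEuclideanLin D` (kept opaque), its characteristic polynomial and its form
  obtain ⟨f, hfdef⟩ : ∃ f : Module.End ℂ (EuclideanSpace ℂ n), f = toEuclideanLin D := ⟨_, rfl⟩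
  have hchar : f.charpoly = D.charpoly := by
    rw [hfdef, show (toEuclideanLin : Matrix n n ℂ ≃ₗ[ℂ] _) =
      Matrix.toLin (PiLp.basisFun 2 ℂ n) (PiLp.basisFun 2 ℂ n) from Matrix.toLpLin_eq_toLin 2 2,
      Matrix.charpoly_toLin]
  have hform : ∀ x : EuclideanSpace ℂ n, (⟪x, f x⟫_ℂ).re =
      (star (WithLp.ofLp x) ⬝ᵥ ((1 / 2 : ℂ) • (D + Dᴴ)) *ᵥ WithLp.ofLp x).re := fun x => by
    rw [hfdef, kyFan_re_inner_toEuclideanLin_eq, kyFan_re_form_hermitianPart]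
  have hpos : ∀ x : EuclideanSpace ℂ n, 0 ≤ (⟪x, f x⟫_ℂ).re := fun x => by
    rw [hform]
    simpa only [RCLike.re_to_complex] using hPSDH.re_dotProduct_nonneg (WithLp.ofLp x)
  -- the floor subspace `W`: vectors orthogonal to the eigenvectors of `H` of level `< 2η`
  set U : Matrix n n ℂ := (hH.eigenvectorUnitary : Matrix n n ℂ) with hU
  let J := {i : n // hH.eigenvalues i < 2 * η}
  let Φ : EuclideanSpace ℂ n →ₗ[ℂ] (J → ℂ) :=
    (LinearMap.funLeft ℂ ℂ (Subtype.val : J → n)) ∘ₗ Uᴴ.mulVecLin ∘ₗ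
      (WithLp.linearEquiv 2 ℂ (n → ℂ)).toLinearMap
  have hΦ : ∀ x, Φ x = fun j : J => (Uᴴ *ᵥ WithLp.ofLp x) j.1 := fun x => rfl
  set W : Submodule ℂ (EuclideanSpace ℂ n) := LinearMap.ker Φ with hWdef
  have hWdim : Fintype.card n ≤ Module.finrank ℂ W + M := by
    have h1 := Φ.finrank_range_add_finrank_ker
    have h2 : Module.finrank ℂ (LinearMap.range Φ) ≤ M :=
      calc Module.finrank ℂ (LinearMap.range Φ) ≤ Module.finrank ℂ (J → ℂ) := Submodule.finrank_le _
        _ = M := by rw [Module.finrank_fintype_fun_eq_card ℂ, hMdef, Fintype.card_subtype]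
    rw [← hWdef, finrank_euclideanSpace] at h1
    omega
  have hWmem : ∀ x ∈ W, ∀ j, hH.eigenvalues j < 2 * η → (Uᴴ *ᵥ WithLp.ofLp x) j = 0 := by
    intro x hx j hj
    have h0 := LinearMap.mem_ker.mp hx
    rw [hΦ x] at h0
    simpa using congrFun h0 ⟨j, hj⟩
  have hWfloor : ∀ x ∈ W, 2 * η * ‖x‖ ^ 2 ≤ (⟪x, f x⟫_ℂ).re := by
    intro x hx
    have hS : ∑ j, ‖(Uᴴ *ᵥ WithLp.ofLp x) j‖ ^ 2 = ∑ j, ‖WithLp.ofLp x j‖ ^ 2 := by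
      rw [hU]
      exact sum_norm_sq_eigenvectorUnitary_conjTranspose_mulVec hH (WithLp.ofLp x)
    rw [hform x, re_form_eq_sum_eigenvalues hH (WithLp.ofLp x), ← hU, EuclideanSpace.norm_sq_eq x,
      ← hS, Finset.mul_sum]
    refine Finset.sum_le_sum fun j _ => ?_
    by_cases hj : hH.eigenvalues j < 2 * η
    · rw [hWmem x hx j hj, norm_zero]
      simp
    · exact mul_le_mul_of_nonneg_right (not_lt.mp hj) (sq_nonneg _)
  -- the spectral subspace `V` of `f` below `Re z < η` (tree: `stub_kyFanTraceCount`)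
  obtain ⟨V, hV, hk', htr', hVK⟩ :=
    Summit.QuantumFields.QCD.Cruxes.TipPricing.CovariantLaplacianFloor.stub_kyFanTraceCount
      (EuclideanSpace ℂ n) f (fun z : ℂ => z.re < η)
  set k := D.charpoly.roots.countP (fun z : ℂ => z.re < η) with hkdef
  have hk : Module.finrank ℂ V = k := by
    rw [hkdef, Multiset.countP_eq_card_filter, ← hchar]
    exact hk'
  have htr : LinearMap.trace ℂ V (f.restrict hV) =
      (D.charpoly.roots.filter fun z : ℂ => z.re < η).sum := by
    rw [← hchar]
    exact htr'
  obtain ⟨hdimVW, hlow⟩ := hVK W (2 * η) hpos hWfloor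
  have h0 : 0 ≤ (LinearMap.trace ℂ V (f.restrict hV)).re := by
    have h := (hVK ⊥ 0 hpos fun x _ => by rw [zero_mul]; exact hpos x).2
    rwa [zero_mul] at h
  -- dimension count: `k ≤ dim (V ∩ W) + M`
  have hdim : k ≤ Module.finrank ℂ ↥(V ⊓ W) + M := by
    rw [finrank_euclideanSpace] at hdimVW
    omega
  by_cases hk0 : k = 0
  · rw [hk0, Nat.cast_zero]
    positivity
  -- the trace of `f|_V`, from above
  have hup : (LinearMap.trace ℂ V (f.restrict hV)).re < k * η := by
    rw [htr, hkdef, Multiset.countP_eq_card_filter]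
    have hne : (D.charpoly.roots.filter fun z : ℂ => z.re < η) ≠ ∅ := by
      intro h
      apply hk0
      rw [hkdef, Multiset.countP_eq_card_filter, h, Multiset.empty_eq_zero, Multiset.card_zero]
    have hlt := Multiset.sum_lt_sum_of_nonempty (f := Complex.re) (g := fun _ => η) hne
      (fun z hz => (Multiset.mem_filter.mp hz).2)
    rw [Multiset.map_const', Multiset.sum_replicate, nsmul_eq_mul] at hlt
    have hre : ((D.charpoly.roots.filter fun z : ℂ => z.re < η).sum).re =
        ((D.charpoly.roots.filter fun z : ℂ => z.re < η).map Complex.re).sum := by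
      simpa using map_multiset_sum Complex.reAddGroupHom
        (D.charpoly.roots.filter fun z : ℂ => z.re < η)
    rw [hre]
    exact hlt
  -- arithmetic: `0 ≤ Re tr < kη` forces `η > 0`; then `2 dim(V ∩ W) < k ≤ dim(V ∩ W) + M`
  have hkpos : (0 : ℝ) < k := by exact_mod_cast Nat.pos_of_ne_zero hk0
  have hη : 0 < η := pos_of_mul_pos_right (h0.trans_lt hup) hkpos.le
  have h3 : 2 * η * (Module.finrank ℂ ↥(V ⊓ W) : ℝ) < k * η := hlow.trans_lt hup
  have hdim' : (k : ℝ) ≤ (Module.finrank ℂ ↥(V ⊓ W) : ℝ) + (M : ℝ) := by exact_mod_cast hdim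
  nlinarith [mul_le_mul_of_nonneg_left hdim' (by positivity : (0 : ℝ) ≤ 2 * η)]

end

end Summit.QuantumFields.QCD.Cruxes.WindowExtinction.ChessboardColdCells
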